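import Summits.Schanuel.Schanuel.Theorems.ZilberEacParamSurfaceDensity
import Summits.Schanuel.Schanuel.Theorems.ZilberEacParamCurveCase
import HarnessLib

/-!
# Polynomially parametrised base curves, XIII: the non-split surfaces `S(g; Q)` lie in
# Mantova–Masser's case (dim-π-S-1-free); case ∧ dense

HONEST FRAMING.  Cell `pub-schanuel` (Zilber's Exponential-Algebraic Closedness, case ladder;
host summit Schanuel), seat 2, gen 19.  Case certificate for the non-split surfaces
`S(g; Q) = {(g₀(t), g₁(t), y) : Q(t; y) = 0}` over a polynomial curve `C = g(ℂ)` (density: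
`ZilberEacParamSurfaceDensity`; Mantova–Masser's OPEN density question, PLMS 2024 §1 p. 5).  If
`Q(t; ·)` has a zero in `(ℂˣ)²` for infinitely many `t`, then `π(S ∩ G²)` is Zariski dense in `C`,
so `dim cl π(S ∩ G²) = dim C = 1` and `cl π(S ∩ G²) = cl C` is not a line of rational slope (file
VII); with file XI, `S` is in case (dim-π-S-1-free).  NOT Schanuel's conjecture (neither used nor
implied; EAC ⇏ SC); `EC(3,2)` stays OPEN; the question stays OPEN in general.
-/

noncomputable section

open Complex MvPolynomial
open Literature.NumberTheory.Transcendental Literature.ModelTheory.Zilber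
open Literature.ModelTheory.ExponentialFields

set_option linter.dupNamespace false

namespace Summit.Schanuel.Schanuel.Theorems

section Case

variable (g₀ g₁ : Polynomial ℂ) {Q : MvPolynomial (Fin 3) ℂ}

/-- `π(S(g; Q) ∩ G²) ⊆ C`. -/
theorem projAdd_image_paramSurface₃_inter_torusLocus_subset (Q : MvPolynomial (Fin 3) ℂ) :
    projAdd '' ({w : Fin 2 ⊕ Fin 2 → ℂ | ∃ t : ℂ, w (Sum.inl 0) = g₀.eval t ∧
        w (Sum.inl 1) = g₁.eval t ∧
        MvPolynomial.eval (Fin.cases t (fun i => w (Sum.inr i)) : Fin 3 → ℂ) Q = 0} ∩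
        torusLocus ℂ 2) ⊆
      {x : Fin 2 → ℂ | ∃ t : ℂ, x 0 = g₀.eval t ∧ x 1 = g₁.eval t} := by
  rintro x ⟨w, ⟨⟨t, hw0, hw1, -⟩, -⟩, rfl⟩
  exact ⟨t, by simpa using hw0, by simpa using hw1⟩

/-- **`I(π(S(g; Q) ∩ G²)) = I(C)`** as soon as `Q(t; ·)` has a torus zero for infinitely many `t`
(a polynomial in `t` vanishing at infinitely many `t` is zero). (new) -/
theorem vanishingIdeal_projAdd_paramSurface₃
    (hfib : Set.Infinite {t : ℂ | ∃ c : Fin 2 → ℂ, c 0 ≠ 0 ∧ c 1 ≠ 0 ∧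
      MvPolynomial.eval ![t, c 0, c 1] Q = 0}) :
    vanishingIdeal ℂ (projAdd '' ({w : Fin 2 ⊕ Fin 2 → ℂ | ∃ t : ℂ, w (Sum.inl 0) = g₀.eval t ∧
        w (Sum.inl 1) = g₁.eval t ∧
        MvPolynomial.eval (Fin.cases t (fun i => w (Sum.inr i)) : Fin 3 → ℂ) Q = 0} ∩
        torusLocus ℂ 2)) =
      vanishingIdeal ℂ {x : Fin 2 → ℂ | ∃ t : ℂ, x 0 = g₀.eval t ∧ x 1 = g₁.eval t} := by
  refine le_antisymm ?_
    (vanishingIdeal_anti_mono (projAdd_image_paramSurface₃_inter_torusLocus_subset g₀ g₁ Q))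
  intro f hf
  rw [vanishingIdeal_paramCurve, RingHom.mem_ker]
  change aeval (![g₀, g₁] : Fin 2 → Polynomial ℂ) f = 0
  apply Polynomial.eq_zero_of_infinite_isRoot
  refine hfib.mono ?_
  rintro t ⟨c, h0, h1, hc⟩
  simp only [Set.mem_setOf_eq, Polynomial.IsRoot, eval_aeval_pair]
  rw [mem_vanishingIdeal_iff] at hf
  have hx : (![g₀.eval t, g₁.eval t] : Fin 2 → ℂ) ∈ projAdd ''
      ({w : Fin 2 ⊕ Fin 2 → ℂ | ∃ t : ℂ, w (Sum.inl 0) = g₀.eval t ∧ w (Sum.inl 1) = g₁.eval t ∧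
        MvPolynomial.eval (Fin.cases t (fun i => w (Sum.inr i)) : Fin 3 → ℂ) Q = 0} ∩
        torusLocus ℂ 2) := by
    refine ⟨Sum.elim ![g₀.eval t, g₁.eval t] c, ⟨⟨t, by simp, by simp, ?_⟩, fun i => ?_⟩, ?_⟩
    · have e : (Fin.cases t (fun i => (Sum.elim ![g₀.eval t, g₁.eval t] c : Fin 2 ⊕ Fin 2 → ℂ)
          (Sum.inr i)) : Fin 3 → ℂ) = ![t, c 0, c 1] := by
        funext i
        refine Fin.cases ?_ (fun j => ?_) i
        · rfl
        · simp only [Fin.cases_succ, Sum.elim_inr]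
          fin_cases j <;> simp
      rw [e]; exact hc
    · fin_cases i
      · simpa using h0
      · simpa using h1
    · funext i; simp
  exact hf _ hx

/-- **`dim cl π(S(g; Q) ∩ G²) = 1`** (torus fibres over infinitely many `t`, `deg g₀ ≥ 1`). (new) -/
theorem addProjDim_paramSurface₃ (hg₀ : 1 ≤ g₀.natDegree)
    (hfib : Set.Infinite {t : ℂ | ∃ c : Fin 2 → ℂ, c 0 ≠ 0 ∧ c 1 ≠ 0 ∧
      MvPolynomial.eval ![t, c 0, c 1] Q = 0}) :
    addProjDim ℂ 2 {w : Fin 2 ⊕ Fin 2 → ℂ | ∃ t : ℂ, w (Sum.inl 0) = g₀.eval t ∧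
        w (Sum.inl 1) = g₁.eval t ∧
        MvPolynomial.eval (Fin.cases t (fun i => w (Sum.inr i)) : Fin 3 → ℂ) Q = 0} = (1 : ℕ) := by
  have h := zariskiDim_paramCurve g₀ g₁ hg₀
  unfold addProjDim
  unfold zariskiDim at h ⊢
  rw [vanishingIdeal_projAdd_paramSurface₃ g₀ g₁ hfib]
  exact h

/-- **The closure of the base is not a line of rational slope** (no relation `m₀ g₀ + m₁ g₁ = c`;
torus fibres over infinitely many `t`). (new) -/
theorem not_isRationalSlopeLine_paramSurface₃
    (hindep : ∀ m : Fin 2 → ℤ, m ≠ 0 → ∀ c : ℂ,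
      Polynomial.C (m 0 : ℂ) * g₀ + Polynomial.C (m 1 : ℂ) * g₁ ≠ Polynomial.C c)
    (hfib : Set.Infinite {t : ℂ | ∃ c : Fin 2 → ℂ, c 0 ≠ 0 ∧ c 1 ≠ 0 ∧
      MvPolynomial.eval ![t, c 0, c 1] Q = 0}) :
    ¬ IsRationalSlopeLine (zeroLocus ℂ (vanishingIdeal ℂ
      (projAdd '' ({w : Fin 2 ⊕ Fin 2 → ℂ | ∃ t : ℂ, w (Sum.inl 0) = g₀.eval t ∧
        w (Sum.inl 1) = g₁.eval t ∧
        MvPolynomial.eval (Fin.cases t (fun i => w (Sum.inr i)) : Fin 3 → ℂ) Q = 0} ∩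
        torusLocus ℂ 2)))) := by
  rw [vanishingIdeal_projAdd_paramSurface₃ g₀ g₁ hfib]
  exact not_isRationalSlopeLine_paramCurve g₀ g₁ hindep

/-- **Case certificate (non-split surfaces over a polynomial curve).**  `deg g₀ ≥ 1`, no relation
`m₀ g₀ + m₁ g₁ = c`, `Q` irreducible with torus fibres over infinitely many `t`: `S(g; Q)` satisfies
the hypotheses of Mantova–Masser's case (dim-π-S-1-free). (new) -/
theorem mmCase_paramSurface₃ (hg₀ : 1 ≤ g₀.natDegree)
    (hindep : ∀ m : Fin 2 → ℤ, m ≠ 0 → ∀ c : ℂ,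
      Polynomial.C (m 0 : ℂ) * g₀ + Polynomial.C (m 1 : ℂ) * g₁ ≠ Polynomial.C c)
    (hirr : Irreducible Q)
    (hfib : Set.Infinite {t : ℂ | ∃ c : Fin 2 → ℂ, c 0 ≠ 0 ∧ c 1 ≠ 0 ∧
      MvPolynomial.eval ![t, c 0, c 1] Q = 0}) :
    MMCaseDimPiOneFree {w : Fin 2 ⊕ Fin 2 → ℂ | ∃ t : ℂ, w (Sum.inl 0) = g₀.eval t ∧
        w (Sum.inl 1) = g₁.eval t ∧
        MvPolynomial.eval (Fin.cases t (fun i => w (Sum.inr i)) : Fin 3 → ℂ) Q = 0} := by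
  obtain ⟨t, c, h0, h1, hc⟩ := hfib.nonempty
  refine ⟨isIrreducibleClosed_paramSurface₃ g₀ g₁ hg₀ hirr, ?_,
    zariskiDim_paramSurface₃ g₀ g₁ hg₀ hirr, addProjDim_paramSurface₃ g₀ g₁ hg₀ hfib,
    not_isRationalSlopeLine_paramSurface₃ g₀ g₁ hindep hfib⟩
  refine ⟨Sum.elim ![g₀.eval t, g₁.eval t] c, ⟨t, by simp, by simp, ?_⟩, fun i => ?_⟩
  · have e : (Fin.cases t (fun i => (Sum.elim ![g₀.eval t, g₁.eval t] c : Fin 2 ⊕ Fin 2 → ℂ)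
        (Sum.inr i)) : Fin 3 → ℂ) = ![t, c 0, c 1] := by
      funext i
      refine Fin.cases ?_ (fun j => ?_) i
      · rfl
      · simp only [Fin.cases_succ, Sum.elim_inr]
        fin_cases j <;> simp
    rw [e]; exact hc
  · fin_cases i
    · simpa using h0
    · simpa using h1

/-- **Mantova–Masser's question on the non-split family: case ∧ dense** (`1 ≤ deg g₀ < deg g₁`,
`Q` irreducible, `t`-equidegree on its `y`-support with two `y₁`-degrees, torus fibres over
infinitely many `t`). [cite: MantovaMasser2023, §1 Further remarks, p. 5 (the question, open in
general)] (new) -/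
theorem unprojectedDensityQuestion_instance_paramSurface₃_of_equidegree (hg₀ : 1 ≤ g₀.natDegree)
    (hlt : g₀.natDegree < g₁.natDegree) (hirr : Irreducible Q)
    (h2 : ∃ m ∈ Q.support, ∃ m' ∈ Q.support, m 2 ≠ m' 2) (N : ℕ)
    (hN : ∀ m ∈ Q.support, m 0 ≤ N)
    (htop : ∀ m ∈ Q.support, ∃ m' ∈ Q.support, m' 0 = N ∧ m' 1 = m 1 ∧ m' 2 = m 2)
    (hfib : Set.Infinite {t : ℂ | ∃ c : Fin 2 → ℂ, c 0 ≠ 0 ∧ c 1 ≠ 0 ∧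
      MvPolynomial.eval ![t, c 0, c 1] Q = 0}) :
    MMCaseDimPiOneFree {w : Fin 2 ⊕ Fin 2 → ℂ | ∃ t : ℂ, w (Sum.inl 0) = g₀.eval t ∧
        w (Sum.inl 1) = g₁.eval t ∧
        MvPolynomial.eval (Fin.cases t (fun i => w (Sum.inr i)) : Fin 3 → ℂ) Q = 0} ∧
      UnprojectedDense {w : Fin 2 ⊕ Fin 2 → ℂ | ∃ t : ℂ, w (Sum.inl 0) = g₀.eval t ∧
        w (Sum.inl 1) = g₁.eval t ∧
        MvPolynomial.eval (Fin.cases t (fun i => w (Sum.inr i)) : Fin 3 → ℂ) Q = 0} :=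
  ⟨mmCase_paramSurface₃ g₀ g₁ hg₀ (paramCurve_indep_of_ne g₀ g₁ hg₀ (by omega) (by omega)) hirr hfib,
    unprojectedDense_paramSurface₃_of_equidegree g₀ g₁ hg₀ hlt hirr h2 N hN htop⟩

end Case

end Summit.Schanuel.Schanuel.Theorems
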